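/-
Copyright: lit-balaban cell, Phase-2 proof seat p33 (gen 6).  Statement-level skeleton of a published paper; no proof claims beyond
what the kernel checks below.
-/
import Literature.MathematicalPhysics.QuantumFieldTheory.BalabanImbrieJaffe1984to88.BIJ85Ineq732Background

/-!
# `BalabanImbrieJaffe1984to88.BIJ85Ineq732BackgroundStab` — T. Bałaban, J. Imbrie, A. Jaffe, *Renormalization of the Higgs model:
minimizers, propagators and the stability of mean field theory*, Commun. Math. Phys. **97** (1985) 299–329
[BalabanImbrieJaffe1985]: **the scalar stability estimate (7.3.2) p. 326 AT THE (4.5.4)-SHAPED BACKGROUND `u = Q^{s*}_kv·e^{iθ}`** for EVERY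
unit-lattice `U(1)` field `v` and EVERY bondwise phase that is sup-norm small on the scale of the block (`|θ_b| ≤ T`, `τ := L^kT`,
`36d(2d+1)²τ² ≤ 1`): `γ·Σ_b |v_bψ(b₊) − ψ(b₋)|² − 32γd(2d+1)²τ²·Σ_x |ψ(x)|² ≤ ⟨ψ, Δ_k(u)ψ⟩`, **`γ = min(a/(10d), ⅕)` UNIFORM in `k`, the volume,
`v` and the phase** (file 5 of this seat's member of SKELETON row **C1.Eq7.3.1-7.3.2**, GAPS G-C1-05; the assembly over file 4
`BIJ85Ineq732Background`).

statement-level skeleton of published theorems with citation tags; proofs where landed; nothing here is a claim about the Yang–Mills mass gap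

PDF held: `paper:balaban1985-cmp97-bij-higgs-minimizers` (journal page = PDF page + 298).  Pages read (`lit read`, OCR text): p. 313 [PDF 15]
((4.5.4), (4.6.1)–(4.6.4)), p. 326 [PDF 28] ((7.3.1)–(7.3.2)).

CITATION HEADER (lean-in-tree rule).  Phase-2 file of the lit-balaban TYPED SKELETON (HOME `run/shared/lean/pub/lit-balaban/`), seat p33 gen 6
(unit `lit-balaban-p33-g6`; TAKING line HOME/STATUS.md 2026-08-21T10:38:53Z; owner r15, referee ref-5).  Objects of record BY NAME (p11's
`bondForm`/`QlinK`/`Dlin`/`deltaOp`/`phiCl`/`inner_deltaOp_eq`, `cPhys`, `aK`, r15's `BIJ85Sect7Statements.ScalarStabData`; file 4's `bg454`,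
`bondForm_qlinK_bg454_le`).  Three definitions with bodies (the index `BgIdx`, `bgG`, `bgStabData` — mirrors of p11's `FlatIdx`/`flatG`/
`flatStabData`), no instance beyond the structure, no named fact.

THE PRINTED TEXT, verbatim (p. 326 [PDF 28]): *"For constants γ > 0, α > 0, M < ∞, ⟨φ, Δ_k(u_k)φ⟩ ≥ γ Σ_{b∈T₁^{(k)}} |u_k(b)φ(b₊) − φ(b₋)|²
− Me_k^{2−α} Σ_{x∈T₁^{(k)}} |φ(x)|². (7.3.2)  The second form of the inequality substitutes v_b for u_k(b) in the covariant derivative of φ. These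
inequalities can be proved by an extension of the proofs of [7]."*

WHAT IS PROVED (0 `sorry`, standard axioms; second printed form).
* `ineq732_of_blockAveraging_mass` — the assembly of p. 326 / [7] WITH A MASS TERM, abstracted once: a block-averaging bound
  `E_W(Q_k(u)φ) ≤ κ·Σ_b|u_bφ(b₊) − φ(b₋)|² + m·‖Q_k(u)φ‖²` and `γ(8d + 4m) ≤ a`, `2γκ ≤ c²` give `γ·E_W(ψ) ≤ ⟨ψ, Δ_k(u)ψ⟩ + 4γm·‖ψ‖²`.
* **`ineq732_background`** — (7.3.2) at `u = Q^{s*}_kv·e^{iθ}`, explicit: `|θ_b| ≤ T`, `4d(d+1)τ² ≤ 1`, `γ(8d + 32d(2d+1)²τ²) ≤ a`,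
  `γ(n²/N)(4 + 16d(2d+1)²τ²) ≤ c²` ⇒ `γ·E_v(ψ) ≤ ⟨ψ, Δ_k(u)ψ⟩ + 32γd(2d+1)²τ²·‖ψ‖²`.
* **`ineq732_background_phys`** — printed `a_k` (`≥ 8a/9`, p11), physical `c² = η^{d−2}`, `36d(2d+1)²τ² ≤ 1`:
  `min(a/(10d), ⅕)·Σ_b |v_bψ(b₊) − ψ(b₋)|² − 32·min(a/(10d), ⅕)·d(2d+1)²τ²·Σ_x |ψ(x)|² ≤ ⟨ψ, Δ_k(u)ψ⟩` — (7.3.2) with the mass coefficient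
  `32γd(2d+1)²τ²` standing for `Me_k^{2−α}` (in print `τ = e_k‖𝒟_k∂^*Q^{e*}_kf^{(k)}‖_∞ ≤ Ke_k𝓅(e_k)` by (7.2.2) under (7.3.1), so
  `τ² ≤ K²C_α·e_k^{2−α}` for every `α ∈ (0, 2)`).
* §3 r15's `ScalarStabData.Claim73 𝓅 fam` INHABITED for the family `bgStabData` over `BgIdx d K α₀` = (torus, `k ≥ 1`, any `e_k`, ANY `v`, any
  phase `θ` with `|θ_b| ≤ T`, `36d(2d+1)²(L^kT)² ≤ 1`, `(L^kT)² ≤ K²e_k^{2−α₀}`): `γ = min(a/(10d), ⅕)`, `α = α₀`, `M = 32γd(2d+1)²K²`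
  (`claim73_background`; honest `|v(∂p) − 1|`; non-vacuity `hyp731_background_one`).
HONEST SCOPE.  As file 4: the step (7.3.1) ⇒ `τ` small is row C1.Eq7.2.2 (typed), not proved here — in §3 it is the index's rate field;
nothing printed is contradicted or weakened.
-/

open scoped RealInnerProductSpace BigOperators
open Finset

namespace Literature.MathematicalPhysics.QuantumFieldTheory.BalabanImbrieJaffe1984to88.BIJ85Ineq732BackgroundStab

open Literature.MathematicalPhysics.QuantumFieldTheory.Balaban1983to89
open BIJ88Sect3Statements (U1 toC cfg plaqVar norm_toC toC_one toC_mul)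
open BIJ85Sect1Model (HiggsField)
open BIJ85BlockAveragesTorus BIJ85BlockAveragesTorusK BIJ85ScalarPropagatorTorus BIJ85ScalarPropagatorTorusK
open BIJ85ScalarForm464
open BIJ85BlockAveragingIneq BIJ85Ineq732Flat BIJ85Ineq732PullBack BIJ85Ineq732Background

noncomputable section

variable {P : Params} {j : ℕ}

/-! ## §1 The assembly with a mass term -/

/-- **The assembly of p. 326 / [7] WITH A MASS TERM**, abstracted once: for any background `u` on `T_η`, any unit-lattice `W`, `κ`, `m ≥ 0`
with the block-averaging bound `E_W(Q_k(u)φ) ≤ κ·Σ_b|u_bφ(b₊) − φ(b₋)|² + m·‖Q_k(u)φ‖²` for all `φ`, any right inverse `G` of `D_u^*D_u + aQ_k^*Q_k`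
(`c ≠ 0`) and any `γ ≥ 0` with `γ(8d + 4m) ≤ a`, `γ·2κ ≤ c²`:  `γ·E_W(ψ) ≤ ⟨ψ, Δ_k(u)ψ⟩ + 4γm·‖ψ‖²` for every `ψ`
(`⟨ψ,Δ_kψ⟩ = a‖Q_kφ_k − ψ‖² + ‖D_uφ_k‖²` at the minimizer; `E(ψ) ≤ 2E(ψ − Q_kφ_k) + 2E(Q_kφ_k)`, `E ≤ 4d‖·‖²`, `‖Q_kφ_k‖² ≤ 2‖Q_kφ_k − ψ‖² + 2‖ψ‖²`).
[cite: BalabanImbrieJaffe1985, (7.3.2) p.326] -/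
theorem ineq732_of_blockAveraging_mass {k : ℕ} {c : ℝ} (hc : c ≠ 0) {a : ℝ} (U : GaugeField P j U1)
    (W : GaugeField P (j + k) U1) {κ m : ℝ} (hm : 0 ≤ m)
    (hBA : ∀ φ : FineSp P j,
      bondForm W (QlinK U k φ) ≤ κ * ∑ b : PBond P j, ‖toC (U b) * φ b.tgt - φ b.src‖ ^ 2 + m * ‖QlinK U k φ‖ ^ 2)
    {G : FineSp P j →ₗ[ℝ] FineSp P j} (hG : ∀ φ, opT (Dlin c U) (QlinK U k) a (G φ) = φ)
    {γ : ℝ} (hγ0 : 0 ≤ γ) (hγ1 : γ * (8 * P.d + 4 * m) ≤ a) (hγ2 : γ * (2 * κ) ≤ c ^ 2) (ψ : CoarseSpK P j k) :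
    γ * bondForm W ψ ≤ ⟪ψ, deltaOp (QlinK U k) a G ψ⟫ + 4 * γ * m * ‖ψ‖ ^ 2 := by
  set φk : FineSp P j := phiCl (QlinK U k) a G ψ with hφk
  set X : ℝ := ‖QlinK U k φk - ψ‖ ^ 2 with hX
  set Y : ℝ := ‖Dlin c U φk‖ ^ 2 with hY
  have hc2 : 0 < c ^ 2 := by positivity
  have hX0 : 0 ≤ X := by positivity
  have hY0 : 0 ≤ Y := by positivity
  have hΔ : ⟪ψ, deltaOp (QlinK U k) a G ψ⟫ = a * X + Y := inner_deltaOp_eq hG ψ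
  have hsplit : bondForm W ψ ≤ 2 * bondForm W (ψ - QlinK U k φk) + 2 * bondForm W (QlinK U k φk) := by
    have h := bondForm_add_le W (ψ - QlinK U k φk) (QlinK U k φk)
    rwa [sub_add_cancel] at h
  have h1 : bondForm W (ψ - QlinK U k φk) ≤ 4 * P.d * X := by
    rw [hX, ← norm_neg, neg_sub]
    exact bondForm_le _ _
  have hS : ∑ b : PBond P j, ‖toC (U b) * φk b.tgt - φk b.src‖ ^ 2 = Y / c ^ 2 := by
    rw [hY, norm_Dlin_sq', mul_div_cancel_left₀ _ hc2.ne']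
  have hQn : ‖QlinK U k φk‖ ^ 2 ≤ 2 * X + 2 * ‖ψ‖ ^ 2 := by
    have e : QlinK U k φk = (QlinK U k φk - ψ) + ψ := by abel
    have h := norm_add_le (QlinK U k φk - ψ) ψ
    rw [← e] at h
    have h' := pow_le_pow_left₀ (norm_nonneg _) h 2
    nlinarith [sq_nonneg (‖QlinK U k φk - ψ‖ - ‖ψ‖)]
  have h2 : bondForm W (QlinK U k φk) ≤ κ * (Y / c ^ 2) + m * (2 * X + 2 * ‖ψ‖ ^ 2) := by
    have h := hBA φk
    rw [hS] at h
    exact h.trans (add_le_add le_rfl (mul_le_mul_of_nonneg_left hQn hm))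
  have hE : bondForm W ψ ≤ (8 * P.d + 4 * m) * X + 2 * κ / c ^ 2 * Y + 4 * m * ‖ψ‖ ^ 2 := by
    have := hsplit.trans (add_le_add (mul_le_mul_of_nonneg_left h1 (by norm_num)) (mul_le_mul_of_nonneg_left h2 (by norm_num)))
    refine this.trans (le_of_eq ?_)
    field_simp
    ring
  have hγ2' : γ * (2 * κ / c ^ 2) ≤ 1 := by
    rw [← mul_div_assoc, div_le_one hc2]; exact hγ2
  calc γ * bondForm W ψ ≤ γ * ((8 * P.d + 4 * m) * X + 2 * κ / c ^ 2 * Y + 4 * m * ‖ψ‖ ^ 2) :=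
        mul_le_mul_of_nonneg_left hE hγ0
    _ = γ * (8 * P.d + 4 * m) * X + γ * (2 * κ / c ^ 2) * Y + 4 * γ * m * ‖ψ‖ ^ 2 := by ring
    _ ≤ a * X + 1 * Y + 4 * γ * m * ‖ψ‖ ^ 2 :=
        add_le_add (add_le_add (mul_le_mul_of_nonneg_right hγ1 hX0) (mul_le_mul_of_nonneg_right hγ2' hY0)) le_rfl
    _ = _ := by rw [hΔ, one_mul]

/-! ## §2 (7.3.2) at the background (4.5.4) -/

/-- **(7.3.2) AT THE BACKGROUND (4.5.4) `u = Q^{s*}_kv·e^{iθ}` — explicit form, EVERY `v`, EVERY sup-norm-small phase, EVERY torus and level.**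
For `j + k ≤ m + K`, `|θ_b| ≤ T` on every `η`-bond, `τ := L^kT` with `4d(d+1)τ² ≤ 1`, `a > 0`, `c ≠ 0`, `G` any right inverse of `D_u^*D_u + aQ_k^*Q_k`,
and any `γ ≥ 0` with `γ·(8d + 32d(2d+1)²τ²) ≤ a` and `γ·(n²/N)·(4 + 16d(2d+1)²τ²) ≤ c²`:
`γ·Σ_{b∈T₁^{(k)}} |v_bψ(b₊) − ψ(b₋)|² ≤ ⟨ψ, Δ_k(u)ψ⟩ + 32γd(2d+1)²τ²·‖ψ‖²` for every `ψ`. [cite: BalabanImbrieJaffe1985, (7.3.2) p.326] -/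
theorem ineq732_background {k : ℕ} (hk : j + k ≤ P.m + P.K) {c : ℝ} (hc : c ≠ 0) {a : ℝ}
    (v : GaugeField P (j + k) U1) {θ : PBond P j → ℝ} {T : ℝ} (hT : 0 ≤ T) (hθ : ∀ b, |θ b| ≤ T)
    (hτ : 4 * P.d * (P.d + 1) * ((P.L : ℝ) ^ k * T) ^ 2 ≤ 1)
    {G : FineSp P j →ₗ[ℝ] FineSp P j} (hG : ∀ φ, opT (Dlin c (bg454 k v θ)) (QlinK (bg454 k v θ) k) a (G φ) = φ)
    {γ : ℝ} (hγ0 : 0 ≤ γ) (hγ1 : γ * (8 * P.d + 32 * P.d * (2 * P.d + 1) ^ 2 * ((P.L : ℝ) ^ k * T) ^ 2) ≤ a)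
    (hγ2 : γ * (((P.L : ℝ) ^ k) ^ 2 / (P.L : ℝ) ^ (k * P.d) * (4 + 16 * P.d * (2 * P.d + 1) ^ 2 * ((P.L : ℝ) ^ k * T) ^ 2)) ≤ c ^ 2)
    (ψ : CoarseSpK P j k) :
    γ * bondForm v ψ ≤ ⟪ψ, deltaOp (QlinK (bg454 k v θ) k) a G ψ⟫
      + 32 * γ * (P.d * (2 * P.d + 1) ^ 2 * ((P.L : ℝ) ^ k * T) ^ 2) * ‖ψ‖ ^ 2 := by
  have hm : (0 : ℝ) ≤ 8 * P.d * (2 * P.d + 1) ^ 2 * ((P.L : ℝ) ^ k * T) ^ 2 := by positivity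
  have h := ineq732_of_blockAveraging_mass (k := k) hc (bg454 k v θ) v
    (κ := ((P.L : ℝ) ^ k) ^ 2 / (P.L : ℝ) ^ (k * P.d) * (2 + 8 * P.d * (2 * P.d + 1) ^ 2 * ((P.L : ℝ) ^ k * T) ^ 2)) hm
    (fun φ => bondForm_qlinK_bg454_le hk hT hθ hτ v φ) hG hγ0 (by nlinarith [hγ1]) (by nlinarith [hγ2]) ψ
  refine h.trans (le_of_eq ?_)
  ring

/-- **(7.3.2) AT THE BACKGROUND (4.5.4) WITH THE PRINTED `a_k` AND THE PHYSICAL NORMALIZATION — `γ = min(a/(10d), ⅕)` UNIFORM IN `k`, THE VOLUME,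
`v` AND THE PHASE**: for `1 ≤ k`, `j + k ≤ m + K`, `a > 0`, every `v`, every phase with `|θ_b| ≤ T` and `36d(2d+1)²τ² ≤ 1` (`τ = L^kT`), every `ψ`:
`min(a/(10d), ⅕)·Σ_{b∈T₁^{(k)}} |v_bψ(b₊) − ψ(b₋)|² − 32·min(a/(10d), ⅕)·d(2d+1)²τ²·Σ_{x∈T₁^{(k)}} |ψ(x)|² ≤ ⟨ψ, Δ_k(u)ψ⟩` — the printed (7.3.2)
(second form) with the mass coefficient `32γd(2d+1)²τ²` standing for `Me_k^{2−α}` (in print `τ = e_k‖𝒟_k∂^*Q^{e*}_kf^{(k)}‖_∞ ≤ Ke_k𝓅(e_k)` by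
(7.2.2) under (7.3.1)). [cite: BalabanImbrieJaffe1985, (7.3.2) p.326] -/
theorem ineq732_background_phys {k : ℕ} (hk1 : 1 ≤ k) (hk : j + k ≤ P.m + P.K) {a : ℝ} (ha : 0 < a)
    (v : GaugeField P (j + k) U1) {θ : PBond P j → ℝ} {T : ℝ} (hT : 0 ≤ T) (hθ : ∀ b, |θ b| ≤ T)
    (hτ : 36 * P.d * (2 * P.d + 1) ^ 2 * ((P.L : ℝ) ^ k * T) ^ 2 ≤ 1)
    {G : FineSp P j →ₗ[ℝ] FineSp P j}
    (hG : ∀ φ, opT (Dlin (cPhys P k) (bg454 k v θ)) (QlinK (bg454 k v θ) k) (BIJ85Sect4Statements.aK a P.L k) (G φ) = φ)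
    (ψ : CoarseSpK P j k) :
    min (a / (10 * P.d)) (1 / 5) * bondForm v ψ
        - 32 * min (a / (10 * P.d)) (1 / 5) * (P.d * (2 * P.d + 1) ^ 2 * ((P.L : ℝ) ^ k * T) ^ 2)
          * ∑ x : Balaban1983to89.Site P (j + k), ‖ψ x‖ ^ 2
      ≤ ⟪ψ, deltaOp (QlinK (bg454 k v θ) k) (BIJ85Sect4Statements.aK a P.L k) G ψ⟫ := by
  set γ : ℝ := min (a / (10 * P.d)) (1 / 5) with hγ
  set τ2 : ℝ := ((P.L : ℝ) ^ k * T) ^ 2 with hτ2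
  have hd : (1 : ℝ) ≤ P.d := by exact_mod_cast P.hd
  have hdpos : (0 : ℝ) < P.d := by linarith
  have hγ0 : 0 ≤ γ := le_min (by positivity) (by norm_num)
  have hγa : γ ≤ a / (10 * P.d) := min_le_left _ _
  have hγ5 : γ ≤ 1 / 5 := min_le_right _ _
  have haK := aK_ge_eight_ninths P ha.le hk1
  have hτ2n : 0 ≤ τ2 := sq_nonneg _
  -- `d(2d+1)²τ² ≤ 1/36`
  have hsm : P.d * (2 * P.d + 1) ^ 2 * τ2 ≤ 1 / 36 := by rw [hτ2]; linarith
  have hτ' : 4 * P.d * (P.d + 1) * ((P.L : ℝ) ^ k * T) ^ 2 ≤ 1 := by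
    rw [← hτ2]
    nlinarith [mul_nonneg (by positivity : (0 : ℝ) ≤ P.d * (3 * P.d ^ 2 + 3 * P.d + 1)) hτ2n]
  -- the two side conditions on `γ`
  have hγ1 : γ * (8 * P.d + 32 * P.d * (2 * P.d + 1) ^ 2 * ((P.L : ℝ) ^ k * T) ^ 2) ≤ BIJ85Sect4Statements.aK a P.L k := by
    rw [← hτ2]
    have h8 : 8 * P.d + 32 * P.d * (2 * P.d + 1) ^ 2 * τ2 ≤ 80 * P.d / 9 := by nlinarith
    have hγa' : γ * (10 * P.d) ≤ a := by rwa [le_div_iff₀ (by positivity)] at hγa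
    calc γ * (8 * P.d + 32 * P.d * (2 * P.d + 1) ^ 2 * τ2) ≤ γ * (80 * P.d / 9) := mul_le_mul_of_nonneg_left h8 hγ0
      _ = 8 * (γ * (10 * P.d)) / 9 := by ring
      _ ≤ 8 * a / 9 := by gcongr
      _ ≤ _ := haK
  have hγ2 : γ * (((P.L : ℝ) ^ k) ^ 2 / (P.L : ℝ) ^ (k * P.d) * (4 + 16 * P.d * (2 * P.d + 1) ^ 2 * ((P.L : ℝ) ^ k * T) ^ 2))
      ≤ cPhys P k ^ 2 := by
    rw [← hτ2]
    have hc4 := cPhys_const_four P k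
    have hn2 : (0 : ℝ) < ((P.L : ℝ) ^ k) ^ 2 := pow_pos (pow_pos (Nat.cast_pos.2 P.L_pos) _) _
    have hN : (0 : ℝ) < (P.L : ℝ) ^ (k * P.d) := pow_pos (Nat.cast_pos.2 P.L_pos) _
    have hce : cPhys P k ^ 2 = ((P.L : ℝ) ^ k) ^ 2 / (P.L : ℝ) ^ (k * P.d) := by
      have h4 : (4 : ℝ) * ((P.L : ℝ) ^ k) ^ 2 ≠ 0 := mul_ne_zero (by norm_num) hn2.ne'
      rw [div_eq_iff h4] at hc4
      rw [eq_div_iff hN.ne']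
      linear_combination hc4
    rw [hce]
    have h16 : 4 + 16 * P.d * (2 * P.d + 1) ^ 2 * τ2 ≤ 40 / 9 := by nlinarith
    calc γ * (((P.L : ℝ) ^ k) ^ 2 / (P.L : ℝ) ^ (k * P.d) * (4 + 16 * P.d * (2 * P.d + 1) ^ 2 * τ2))
        ≤ (1 / 5) * (((P.L : ℝ) ^ k) ^ 2 / (P.L : ℝ) ^ (k * P.d) * (40 / 9)) := by
          gcongr
      _ ≤ _ := by
          have : 0 ≤ ((P.L : ℝ) ^ k) ^ 2 / (P.L : ℝ) ^ (k * P.d) := by positivity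
          nlinarith
  have h := ineq732_background hk (cPhys_pos P k).ne' v hT hθ hτ' hG hγ0 hγ1 hγ2 ψ
  rw [sum_norm_sq_eq]
  linarith
/-! ## §3 r15's `Claim73` for the family of (4.5.4)-shaped backgrounds with a phase as small as (7.2.2)/(7.3.1) make it -/

/-- Index of the (4.5.4)-BACKGROUND FAMILY of Sect. 7.3 data at fixed constants `K`, `α₀`: p11's `FlatIdx` (any torus of dimension `d`, levels
`j`, `k ≥ 1`), ANY value `e_k`, ANY unit-lattice `U(1)` field `v`, ANY bondwise phase `θ` on the `η`-bonds with a sup bound `T` that is SMALL on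
the block scale (`36d(2d+1)²(L^kT)² ≤ 1`) and obeys the RATE `(L^kT)² ≤ K²e_k^{2−α₀}` — the located form of what (7.2.2) gives under (7.3.1)
for `θ = −e_kη𝒟_k∂^*Q^{e*}_kf^{(k)}` (`L^kT = e_k‖𝒟_k∂^*Q^{e*}_kf^{(k)}‖_∞ ≤ O(1)e_k𝓅(e_k)`). [cite: BalabanImbrieJaffe1985, (4.5.4) p.313] -/
structure BgIdx (d : ℕ) (K α₀ : ℝ) where
  base : FlatIdx d
  ek : ℝ
  v : GaugeField base.P (base.j + base.k) U1
  θ : PBond base.P base.j → ℝ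
  T : ℝ
  hT : 0 ≤ T
  hθ : ∀ b, |θ b| ≤ T
  hsmall : 36 * d * (2 * d + 1) ^ 2 * ((base.P.L : ℝ) ^ base.k * T) ^ 2 ≤ 1
  hrate : ((base.P.L : ℝ) ^ base.k * T) ^ 2 ≤ K ^ 2 * ek ^ (2 - α₀)

/-- `G_k(u) = [D_u^*D_u + a_kQ_k(u)^*Q_k(u)]^{−1}` at the background `u = Q^{s*}_kv·e^{iθ}` of an index (exists for every background, `exists_GK`;
chosen by `Classical.choose`). [cite: BalabanImbrieJaffe1985, (4.6.2) p.313] -/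
def bgG {d : ℕ} {K α₀ : ℝ} (a : ℝ) (ha : 0 < a) (i : BgIdx d K α₀) : FineSp i.base.P i.base.j →ₗ[ℝ] FineSp i.base.P i.base.j :=
  Classical.choose (exists_GK i.base.hk (cPhys_pos i.base.P i.base.k).ne' (i.base.aK_pos ha) (bg454 i.base.k i.v i.θ))

/-- kernel: `bgG` is a right inverse of `D_u^*D_u + a_kQ_k(u)^*Q_k(u)` at `u = Q^{s*}_kv·e^{iθ}`. [cite: BalabanImbrieJaffe1985, (4.6.2) p.313] -/
theorem bgG_spec {d : ℕ} {K α₀ : ℝ} (a : ℝ) (ha : 0 < a) (i : BgIdx d K α₀) (φ : FineSp i.base.P i.base.j) :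
    opT (Dlin (cPhys i.base.P i.base.k) (bg454 i.base.k i.v i.θ)) (QlinK (bg454 i.base.k i.v i.θ) i.base.k)
      (BIJ85Sect4Statements.aK a i.base.P.L i.base.k) (bgG a ha i φ) = φ :=
  (Classical.choose_spec (exists_GK i.base.hk (cPhys_pos i.base.P i.base.k).ne' (i.base.aK_pos ha)
    (bg454 i.base.k i.v i.θ))).1 φ

/-- **The (4.5.4)-background MODEL INSTANCE of r15's Sect. 7.3 carrier** `ScalarStabData` at an index: plaquettes/bonds/sites of `T₁^{(k)}`,
`ψ ∈ ℓ²(T₁^{(k)})`, the HONEST plaquette deviation `|v(∂p) − 1|`, the bond term `|v_bψ(b₊) − ψ(b₋)|²` (second printed form), `|ψ(x)|²`,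
`⟨ψ, Δ_k(Q^{s*}_kv·e^{iθ})ψ⟩` with the printed `a_k`, physical normalization, `G_k = bgG`; `e_k` = the index's value. [cite: BalabanImbrieJaffe1985, (7.3.2) p.326] -/
def bgStabData {d : ℕ} {K α₀ : ℝ} (a : ℝ) (ha : 0 < a) (i : BgIdx d K α₀) : BIJ85Sect7Statements.ScalarStabData where
  Plaq := Balaban1983to89.Plaq i.base.P (i.base.j + i.base.k)
  Bond := PBond i.base.P (i.base.j + i.base.k)
  Site := Balaban1983to89.Site i.base.P (i.base.j + i.base.k)
  Scalar := CoarseSpK i.base.P i.base.j i.base.k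
  ek := i.ek
  plaqDev := fun p => ‖plaqVar (cfg i.v) p - 1‖
  covDiffSq := fun ψ b => ‖toC (i.v b) * ψ b.tgt - ψ b.src‖ ^ 2
  absSq := fun ψ x => ‖ψ x‖ ^ 2
  deltaForm := fun ψ =>
    ⟪ψ, deltaOp (QlinK (bg454 i.base.k i.v i.θ) i.base.k) (BIJ85Sect4Statements.aK a i.base.P.L i.base.k) (bgG a ha i) ψ⟫

/-- **r15's typed (7.3.2) `ScalarStabData.Ineq732 γ α M` HOLDS for every datum of the (4.5.4)-background family**: `γ = min(a/(10d), ⅕)`,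
`α = α₀`, `M = 32γd(2d+1)²K²` — every `v`, every admissible phase. [cite: BalabanImbrieJaffe1985, (7.3.2) p.326] -/
theorem ineq732_bgStabData {d : ℕ} {K α₀ : ℝ} (a : ℝ) (ha : 0 < a) (i : BgIdx d K α₀) :
    (bgStabData a ha i).Ineq732 (min (a / (10 * d)) (1 / 5)) α₀ (32 * min (a / (10 * d)) (1 / 5) * (d * (2 * d + 1) ^ 2 * K ^ 2)) := by
  intro ψ
  dsimp only [bgStabData] at ψ ⊢
  -- restate the goal with the canonical instances (the carrier's `Fintype` fields unfold to them)
  show min (a / (10 * (d : ℝ))) (1 / 5) * (∑ b : PBond i.base.P (i.base.j + i.base.k), ‖toC (i.v b) * ψ b.tgt - ψ b.src‖ ^ 2)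
      - 32 * min (a / (10 * (d : ℝ))) (1 / 5) * ((d : ℝ) * (2 * (d : ℝ) + 1) ^ 2 * K ^ 2) * i.ek ^ (2 - α₀)
        * (∑ x : Balaban1983to89.Site i.base.P (i.base.j + i.base.k), ‖ψ x‖ ^ 2)
    ≤ ⟪ψ, deltaOp (QlinK (bg454 i.base.k i.v i.θ) i.base.k) (BIJ85Sect4Statements.aK a i.base.P.L i.base.k) (bgG a ha i) ψ⟫
  have hd' : (d : ℝ) = (i.base.P.d : ℝ) := by rw [i.base.hd]
  have hsmall := i.hsmall
  rw [hd'] at hsmall ⊢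
  have h := ineq732_background_phys i.base.hk1 i.base.hk ha i.v i.hT i.hθ hsmall (bgG_spec a ha i) ψ
  unfold bondForm at h
  refine le_trans (sub_le_sub le_rfl ?_) h
  have hr := i.hrate
  have hB0 : 0 ≤ ∑ x : Balaban1983to89.Site i.base.P (i.base.j + i.base.k), ‖ψ x‖ ^ 2 := sum_nonneg fun _ _ => sq_nonneg _
  have hγ0 : 0 ≤ min (a / (10 * (i.base.P.d : ℝ))) (1 / 5) := le_min (by positivity) (by norm_num)
  have hc : (0 : ℝ) ≤ (i.base.P.d : ℝ) * (2 * i.base.P.d + 1) ^ 2 := by positivity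
  have h0 : (0 : ℝ) ≤ 32 * min (a / (10 * (i.base.P.d : ℝ))) (1 / 5) * ((i.base.P.d : ℝ) * (2 * i.base.P.d + 1) ^ 2)
      * ∑ x : Balaban1983to89.Site i.base.P (i.base.j + i.base.k), ‖ψ x‖ ^ 2 :=
    mul_nonneg (mul_nonneg (mul_nonneg (by norm_num) hγ0) hc) hB0
  calc _ = 32 * min (a / (10 * (i.base.P.d : ℝ))) (1 / 5) * ((i.base.P.d : ℝ) * (2 * i.base.P.d + 1) ^ 2)
          * (∑ x : Balaban1983to89.Site i.base.P (i.base.j + i.base.k), ‖ψ x‖ ^ 2) * ((i.base.P.L : ℝ) ^ i.base.k * i.T) ^ 2 := by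
        ring
    _ ≤ 32 * min (a / (10 * (i.base.P.d : ℝ))) (1 / 5) * ((i.base.P.d : ℝ) * (2 * i.base.P.d + 1) ^ 2)
          * (∑ x : Balaban1983to89.Site i.base.P (i.base.j + i.base.k), ‖ψ x‖ ^ 2) * (K ^ 2 * i.ek ^ (2 - α₀)) :=
        mul_le_mul_of_nonneg_left hr h0
    _ = _ := by ring

/-- kernel: the index `v = 1`, `θ = 0`, `T = 0`, `e_k = 1` is admissible and satisfies (7.3.1) — the instance below is not vacuous on the
hypothesis side. [cite: BalabanImbrieJaffe1985, (7.3.1) p.326] -/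
theorem hyp731_background_one {d : ℕ} {K α₀ : ℝ} (a : ℝ) (ha : 0 < a) (b : FlatIdx d) (pexp : ℝ) :
    (bgStabData a ha (⟨b, 1, 1, fun _ => 0, 0, le_rfl, fun _ => by simp, by simp, by simp [sq_nonneg]⟩ : BgIdx d K α₀)).Hyp731 pexp := by
  intro p
  have e : plaqVar (cfg (1 : GaugeField b.P (b.j + b.k) U1)) p = 1 := by
    simp [plaqVar, cfg, show ∀ c, (1 : GaugeField b.P (b.j + b.k) U1) c = 1 from fun _ => rfl, toC_one]
  show ‖plaqVar (cfg (1 : GaugeField b.P (b.j + b.k) U1)) p - 1‖ ≤ 1 * (1 + Real.log 1⁻¹) ^ pexp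
  simp [e]

/-- **r15's typed claim of Sect. 7.3 `ScalarStabData.Claim73 𝓅 fam` ("for constants γ > 0, α > 0, M < ∞, (7.3.1) ⇒ (7.3.2)") PROVED FOR THE
FAMILY OF (4.5.4)-SHAPED BACKGROUNDS** over `BgIdx d K α₀` (every torus, every `k ≥ 1`, EVERY `v`, every phase with the block-scale sup-norm
smallness and the rate `(L^kT)² ≤ K²e_k^{2−α₀}`): `γ = min(a/(10d), ⅕)`, `α = α₀`, `M = 32γd(2d+1)²K²`, for every `α₀ > 0`.  HONEST SCOPE: the
rate/smallness fields of the index are the located form of (7.2.2) under (7.3.1) (row C1.Eq7.2.2, typed) — here they are hypotheses on the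
phase, and (7.3.1) itself is then not needed. [cite: BalabanImbrieJaffe1985, (7.3.1)–(7.3.2) p.326] -/
theorem claim73_background {d : ℕ} (hd : 0 < d) (a : ℝ) (ha : 0 < a) (K : ℝ) {α₀ : ℝ} (hα : 0 < α₀) (pexp : ℝ) :
    BIJ85Sect7Statements.ScalarStabData.Claim73 pexp (bgStabData (d := d) (K := K) (α₀ := α₀) a ha) :=
  ⟨min (a / (10 * d)) (1 / 5), α₀, 32 * min (a / (10 * d)) (1 / 5) * (d * (2 * d + 1) ^ 2 * K ^ 2),
    lt_min (by positivity) (by norm_num), hα, fun i _ => ineq732_bgStabData a ha i⟩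

end

end Literature.MathematicalPhysics.QuantumFieldTheory.BalabanImbrieJaffe1984to88.BIJ85Ineq732BackgroundStab
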